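/-
Copyright (c) 2026 the pub-hodgecm-mathlib formalisation cell (harness21).  Prover seat hodgecm-mathlib-K2Liu-p14 (g2), Track B «K2-LIT»,
#184♮ = hLiu418 = `stmt-HodgeConjecture-24832`; #42S organ S2, road (γ) (M-158g): interface item (iv) of ★ FILE 2′ `K2LiuArchSWImageSlotStability` at the instance
(K2Liu-p14 (g2) 13:48:55Z ∕ 13:54:04Z; K2Liu-p11 (g2) 13:46:30Z letters; K2Liu-ref1 (g5) 13:55:00Z pin: honest hypothesis `det (v w′) ≠ 0` off `w`).
-/
import Summits.HodgeConjecture.HodgeConjecture.Theorems.K2LiuU22MultiPlaceCarrierDefs    -- ★ p860776 `MCarrier`, `uM`, `DinvM`, `dM`, `evM` (K2Liu-p11)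
import Summits.HodgeConjecture.HodgeConjecture.Theorems.K2LiuU22CompactPictureDefs     -- ★ DEFS `Carrier`, `uMat`, `dInv`, `pd`, `evalAt`, generic `pOp ∕ mOp ∕ lOp ∕ rOp` (K2Liu-p10)
import HarnessLib

/-!
# Crux `HLiu418`, organ S2, road (γ): PARTIAL EVALUATION OF THE MULTI-PLACE CARRIER AT THE FROZEN PLACES — `πM_w,v : ℂ[u_{w′} : w′][∏ D⁻¹] →ₐ[ℂ] ℂ[u, D⁻¹]`
# (keep the place `w` symbolic, evaluate every other place at `v w′`), its values on the generators, `ev_{v w} ∘ πM_w,v = ev_v`, and the NATURALITY with the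
# place-`w` derivations and Weil operators (`πM ∘ ∂_{ij,w} = ∂_{ij} ∘ πM`, `πM ∘ P_{ab,w} = P_{ab} ∘ πM`, …) — ★ FILE 2′'s binders `πw, hπp, hπm, hπl, hπr` at the instance

Cell `hodgecm-mathlib`, crux item hLiu418 = `stmt-HodgeConjecture-24832`; squad K2 ∕ K2Liu; prover K2Liu-p14 (g2).  DEFINITION lane (two `def`s with bodies:
`frozenPt`, `πM`; no instance, no notation, no named-fact hypothesis, no `sorry`); `--supports stmt-HodgeConjecture-24832 --as helper`.
* §1 `frozenPt ι w v` (the substitution `X_{ij,w} ↦ u_{ij}`, `X_{ij,w′} ↦ (v w′)_{ij}`), `aeval_frozenPt_detPolyAt_self ∕ _of_ne`, `aeval_frozenPt_multiDet`, `isUnit_aeval_frozenPt_multiDet`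
  (HONEST hypothesis `hv : ∀ w′ ≠ w, det (v w′) ≠ 0`);
* §2 **`πM ι w v hv : MCarrier ι →ₐ[ℂ] Carrier`** (`IsLocalization.Away.lift`, as ★ `evalAt` ∕ ★ `evM`); `πM_algebraMap`, **`πM_uM_same`**, `πM_uM_of_ne`, `mapMatrix_πM_uM`, `πM_det_uM_same`,
  **`πM_DinvM_same`**, **`evalAt_πM`** (`ev_{v w} ∘ πM_{w,v} = ev_v`, ★ FILE 2′'s reading of `Z` at one place);
* §3 NATURALITY: `pd_frozenPt`, `aeval_frozenPt_pderiv` (polynomials, `MvPolynomial.induction_on`), **`πM_dM_same`** (to the localisation by the unit trick `r·Δᵏ = P`),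
  **`πM_pOp`, `πM_mOp`, `πM_lOp`, `πM_rOp`** (★ DEFS `pOp_apply` … + `RingHom.map_adjugate`).
References: [LeeZhu1998, §5 p. 5032]; [KashiwaraVergne1978, §II.5].
HONEST LABEL.  Count-neutral helper: `HC_CM` is proved only modulo the 7 printed citations (2 remaining named inputs: hLiu418 = `stmt-HodgeConjecture-24832`,
h413 = `stmt-HodgeConjecture-24833`) until rung 0 closes.
-/

set_option autoImplicit false
set_option linter.dupNamespace false -- the mandated namespace repeats `HodgeConjecture.HodgeConjecture`

noncomputable section

open MvPolynomial Matrix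
open Summit.HodgeConjecture.HodgeConjecture.Cruxes.HLiu418.K2LiuU22CompactPictureDefs
open Summit.HodgeConjecture.HodgeConjecture.Cruxes.HLiu418.K2LiuU22MultiPlaceCarrierDefs
open Summit.HodgeConjecture.HodgeConjecture.Cruxes.HLiu418.K2LiuPolynomialLocalizationDerivationDefs

namespace Summit.HodgeConjecture.HodgeConjecture.Cruxes.HLiu418.K2LiuU22MultiPlacePartialEvalDefs

variable (ι : Type) [Fintype ι] [DecidableEq ι] (w : ι) (v : ι → Matrix (Fin 2) (Fin 2) ℂ)

/-! ## §1 The substitution and the unit -/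

/-- **the frozen substitution**: `X_{ij,w} ↦ u_{ij} ∈ ℂ[u, D⁻¹]`, `X_{ij,w′} ↦ (v w′)_{ij} ∈ ℂ` for `w′ ≠ w`. [cite: LeeZhu1998, §5 p. 5032] -/
def frozenPt : (Fin 2 × Fin 2) × ι → Carrier :=
  fun s => if s.2 = w then uMat s.1.1 s.1.2 else algebraMap ℂ Carrier (v s.2 s.1.1 s.1.2)

omit [Fintype ι] in
/-- value of the substitution at a place-`w` variable. [folklore] -/
theorem frozenPt_same (i j : Fin 2) : frozenPt ι w v ((i, j), w) = uMat i j := by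
  simp [frozenPt]

omit [Fintype ι] in
/-- value of the substitution at a frozen variable. [folklore] -/
theorem frozenPt_of_ne {w' : ι} (h : w' ≠ w) (i j : Fin 2) : frozenPt ι w v ((i, j), w') = algebraMap ℂ Carrier (v w' i j) := by
  simp [frozenPt, h]

omit [Fintype ι] in
/-- `det_w ↦ det u`. [folklore] -/
theorem aeval_frozenPt_detPolyAt_self : MvPolynomial.aeval (frozenPt ι w v) (detPolyAt ι w) = uMat.det := by
  rw [detPolyAt, Matrix.det_fin_two, map_sub, map_mul, map_mul, aeval_X, aeval_X, aeval_X, aeval_X, frozenPt_same, frozenPt_same, frozenPt_same, frozenPt_same]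

omit [Fintype ι] in
/-- `det_{w′} ↦ det (v w′)` (a constant) for `w′ ≠ w`. [folklore] -/
theorem aeval_frozenPt_detPolyAt_of_ne {w' : ι} (h : w' ≠ w) : MvPolynomial.aeval (frozenPt ι w v) (detPolyAt ι w') = algebraMap ℂ Carrier (v w').det := by
  rw [detPolyAt, Matrix.det_fin_two, map_sub, map_mul, map_mul, aeval_X, aeval_X, aeval_X, aeval_X, frozenPt_of_ne ι w v h, frozenPt_of_ne ι w v h,
    frozenPt_of_ne ι w v h, frozenPt_of_ne ι w v h, map_sub, map_mul, map_mul]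

/-- `∏ det ↦ det u · ∏_{w′≠w} det (v w′)`. [folklore] -/
theorem aeval_frozenPt_multiDet :
    MvPolynomial.aeval (frozenPt ι w v) (multiDet ι) = uMat.det * algebraMap ℂ Carrier (∏ w' ∈ Finset.univ.erase w, (v w').det) := by
  rw [multiDet, map_prod, ← Finset.mul_prod_erase Finset.univ _ (Finset.mem_univ w), aeval_frozenPt_detPolyAt_self, map_prod]
  congr 1
  exact Finset.prod_congr rfl fun w' hw' => aeval_frozenPt_detPolyAt_of_ne ι w v (Finset.ne_of_mem_erase hw')

/-- the image of `∏ det` is a unit when the frozen points are invertible (HONEST hypothesis off `w` only). [folklore] -/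
theorem isUnit_aeval_frozenPt_multiDet (hv : ∀ w', w' ≠ w → (v w').det ≠ 0) : IsUnit (MvPolynomial.aeval (frozenPt ι w v) (multiDet ι)) := by
  rw [aeval_frozenPt_multiDet]
  exact isUnit_det_uMat.mul ((isUnit_iff_ne_zero.2 (Finset.prod_ne_zero_iff.2 fun w' hw' => hv w' (Finset.ne_of_mem_erase hw'))).map _)

/-- the same for the underlying ring hom (the form `IsLocalization.Away.lift` wants). [folklore] -/
theorem isUnit_aeval_frozenPt_multiDet' (hv : ∀ w', w' ≠ w → (v w').det ≠ 0) :
    IsUnit ((MvPolynomial.aeval (frozenPt ι w v)).toRingHom (multiDet ι)) := by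
  rw [AlgHom.toRingHom_eq_coe, RingHom.coe_coe]
  exact isUnit_aeval_frozenPt_multiDet ι w v hv

/-! ## §2 The partial evaluation `πM` -/

/-- **PARTIAL EVALUATION AT THE FROZEN PLACES `πM_{w,v} : ℂ[u_{w′} : w′][∏ D⁻¹] →ₐ[ℂ] ℂ[u, D⁻¹]`** — keep the place `w` symbolic (`u_{ij,w} ↦ u_{ij}`), evaluate every other
place at `v w′` (`det (v w′) ≠ 0`). [cite: LeeZhu1998, §5 p. 5032] -/
def πM (hv : ∀ w', w' ≠ w → (v w').det ≠ 0) : MCarrier ι →ₐ[ℂ] Carrier :=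
  { IsLocalization.Away.lift (multiDet ι) (g := (MvPolynomial.aeval (frozenPt ι w v)).toRingHom) (isUnit_aeval_frozenPt_multiDet' ι w v hv) with
    commutes' := fun c => by
      simp only [AlgHom.toRingHom_eq_coe, RingHom.toMonoidHom_eq_coe, OneHom.toFun_eq_coe, MonoidHom.toOneHom_coe, MonoidHom.coe_coe]
      rw [IsScalarTower.algebraMap_apply ℂ (MvPolynomial ((Fin 2 × Fin 2) × ι) ℂ) (MCarrier ι), IsLocalization.Away.lift_eq, RingHom.coe_coe,
        AlgHom.commutes] }

variable (hv : ∀ w', w' ≠ w → (v w').det ≠ 0)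

/-- `πM` on the image of a polynomial is the frozen substitution. [folklore] -/
theorem πM_algebraMap (P : MvPolynomial ((Fin 2 × Fin 2) × ι) ℂ) :
    πM ι w v hv (algebraMap (MvPolynomial ((Fin 2 × Fin 2) × ι) ℂ) (MCarrier ι) P) = MvPolynomial.aeval (frozenPt ι w v) P :=
  IsLocalization.Away.lift_eq (multiDet ι) (isUnit_aeval_frozenPt_multiDet' ι w v hv) P

/-- **`πM (u_{ij,w}) = u_{ij}`**. [cite: LeeZhu1998, §5 p. 5032] -/
theorem πM_uM_same (i j : Fin 2) : πM ι w v hv (uM ι w i j) = uMat i j := by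
  rw [uM_apply, πM_algebraMap, aeval_X, frozenPt_same]

/-- `πM (u_{ij,w′}) = (v w′)_{ij}` for `w′ ≠ w`. [folklore] -/
theorem πM_uM_of_ne {w' : ι} (h : w' ≠ w) (i j : Fin 2) : πM ι w v hv (uM ι w' i j) = algebraMap ℂ Carrier (v w' i j) := by
  rw [uM_apply, πM_algebraMap, aeval_X, frozenPt_of_ne ι w v h]

/-- `πM` maps the coordinate matrix of the place `w` to `u`. [folklore] -/
theorem mapMatrix_πM_uM : (πM ι w v hv).toRingHom.mapMatrix (uM ι w) = uMat := by
  ext i j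
  exact πM_uM_same ι w v hv i j

/-- `πM (det u_w) = det u`. [folklore] -/
theorem πM_det_uM_same : πM ι w v hv (uM ι w).det = uMat.det := by
  have h := RingHom.map_det (πM ι w v hv).toRingHom (uM ι w)
  rw [mapMatrix_πM_uM] at h
  exact h

/-- **`πM (D_w⁻¹) = D⁻¹`**. [cite: LeeZhu1998, §5 p. 5032] -/
theorem πM_DinvM_same : πM ι w v hv (DinvM ι w) = dInv := by
  have h := congrArg (πM ι w v hv) (det_uM_mul_DinvM ι w)
  rw [map_mul, map_one, πM_det_uM_same] at h
  exact isUnit_det_uMat.mul_right_inj.1 (h.trans det_uMat_mul_dInv.symm)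

/-- `πM (adj(u_w)_{ba}) = adj(u)_{ba}`. [folklore] -/
theorem πM_adjugate_uM (a b : Fin 2) : πM ι w v hv ((uM ι w).adjugate b a) = uMat.adjugate b a := by
  have h := RingHom.map_adjugate (πM ι w v hv).toRingHom (uM ι w)
  rw [mapMatrix_πM_uM] at h
  have h' := congrFun (congrFun h b) a
  simpa using h'

/-- **`ev_{v w} ∘ πM_{w,v} = ev_v`** (★ FILE 2′ reads the multi-place `Z` at one place through this). [cite: LeeZhu1998, §5 p. 5032] -/
theorem evalAt_πM (hv' : ∀ w', (v w').det ≠ 0) (r : MCarrier ι) : evalAt (v w) (hv' w) (πM ι w v hv r) = evM ι v hv' r := by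
  have key : ((evalAt (v w) (hv' w)).toRingHom.comp (πM ι w v hv).toRingHom).comp (algebraMap (MvPolynomial ((Fin 2 × Fin 2) × ι) ℂ) (MCarrier ι)) =
      (evM ι v hv').toRingHom.comp (algebraMap (MvPolynomial ((Fin 2 × Fin 2) × ι) ℂ) (MCarrier ι)) := by
    refine MvPolynomial.ringHom_ext (fun c => ?_) (fun s => ?_)
    · simp only [RingHom.comp_apply, AlgHom.toRingHom_eq_coe, RingHom.coe_coe]
      rw [← MvPolynomial.algebraMap_eq, ← IsScalarTower.algebraMap_apply ℂ (MvPolynomial ((Fin 2 × Fin 2) × ι) ℂ) (MCarrier ι), AlgHom.commutes, AlgHom.commutes,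
        AlgHom.commutes]
    · obtain ⟨⟨i, j⟩, w'⟩ := s
      simp only [RingHom.comp_apply, AlgHom.toRingHom_eq_coe, RingHom.coe_coe, ← uM_apply, evM_uM]
      by_cases hw : w' = w
      · subst hw
        rw [πM_uM_same, evalAt_uMat]
      · rw [πM_uM_of_ne ι w v hv hw, AlgHom.commutes]
        rfl
  have h := IsLocalization.ringHom_ext (Submonoid.powers (multiDet ι)) key
  exact congrFun (congrArg (fun f : MCarrier ι →+* ℂ => (f : MCarrier ι → ℂ)) h) r

/-! ## §3 Naturality with the place-`w` derivations and operators -/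

omit [Fintype ι] in
/-- `∂_{ij}` of the frozen substitution: `δ` at the place `w`, `0` at the frozen variables. [cite: KashiwaraVergne1978, §II.5] -/
theorem pd_frozenPt (i j : Fin 2) (n : (Fin 2 × Fin 2) × ι) : pd i j (frozenPt ι w v n) = if n = ((i, j), w) then 1 else 0 := by
  obtain ⟨⟨k, l⟩, w'⟩ := n
  by_cases hw : w' = w
  · subst hw
    rw [frozenPt_same, pd_uMat]
    by_cases hk : i = k <;> by_cases hl : j = l <;> simp [hk, hl, eq_comm]
  · rw [frozenPt_of_ne ι w v hw, Derivation.map_algebraMap, if_neg]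
    simp [hw]

omit [Fintype ι] in
/-- **naturality on polynomials**: `(frozen substitution) (∂P∕∂X_{ij,w}) = ∂_{ij} ((frozen substitution) P)`. [cite: KashiwaraVergne1978, §II.5] -/
theorem aeval_frozenPt_pderiv (i j : Fin 2) (P : MvPolynomial ((Fin 2 × Fin 2) × ι) ℂ) :
    MvPolynomial.aeval (frozenPt ι w v) (pderiv ((i, j), w) P) = pd i j (MvPolynomial.aeval (frozenPt ι w v) P) := by
  induction P using MvPolynomial.induction_on with
  | C a => rw [pderiv_C, map_zero, MvPolynomial.algHom_C, Derivation.map_algebraMap]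
  | add p q hp hq => rw [map_add, map_add, map_add, map_add, hp, hq]
  | mul_X p n hp =>
    rw [pderiv_mul, map_add, map_mul, map_mul, hp, map_mul, aeval_X, Derivation.leibniz, pderiv_X, Pi.single_apply, apply_ite (MvPolynomial.aeval (frozenPt ι w v)),
      map_one, map_zero, pd_frozenPt, smul_eq_mul, smul_eq_mul]
    ring

/-- **NATURALITY WITH THE DERIVATIONS: `πM (∂_{ij,w} r) = ∂_{ij} (πM r)`** for every `r` in the multi-place carrier (polynomials by §3's induction, then the localisation by the
unit trick `r · (∏ det)ᵏ = P`). [cite: KashiwaraVergne1978, §II.5] -/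
theorem πM_dM_same (i j : Fin 2) (r : MCarrier ι) : πM ι w v hv (dM ι w i j r) = pd i j (πM ι w v hv r) := by
  have hpoly : ∀ P : MvPolynomial ((Fin 2 × Fin 2) × ι) ℂ,
      πM ι w v hv (dM ι w i j (algebraMap _ (MCarrier ι) P)) = pd i j (πM ι w v hv (algebraMap _ (MCarrier ι) P)) := fun P => by
    rw [dM_algebraMap, πM_algebraMap, πM_algebraMap, aeval_frozenPt_pderiv]
  obtain ⟨⟨P, ⟨m, hm⟩⟩, hr⟩ := IsLocalization.surj (Submonoid.powers (multiDet ι)) r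
  obtain ⟨k, rfl⟩ := hm
  simp only at hr
  -- `E(r · Δᵏ) = 0` expanded by Leibniz on both sides
  have hE := hpoly P
  rw [← hr, Derivation.leibniz, smul_eq_mul, smul_eq_mul] at hE
  simp only [map_add, map_mul] at hE
  rw [hpoly, Derivation.leibniz, smul_eq_mul, smul_eq_mul, add_right_inj] at hE
  -- `πM (Δᵏ) · (πM (∂ r) − ∂ (πM r)) = 0` with `πM (Δᵏ)` a unit
  have hu : IsUnit (πM ι w v hv (algebraMap (MvPolynomial ((Fin 2 × Fin 2) × ι) ℂ) (MCarrier ι) (multiDet ι ^ k))) := by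
    rw [πM_algebraMap, map_pow]
    exact (isUnit_aeval_frozenPt_multiDet ι w v hv).pow k
  exact hu.mul_right_inj.1 hE

/-- **`πM ∘ P_{ab,w} = P_{ab} ∘ πM`** (★ FILE 2′'s `hπp` at the instance). [cite: LeeZhu1998, §5 p. 5032] -/
theorem πM_pOp (p : ℂ) (a b : Fin 2) (r : MCarrier ι) :
    πM ι w v hv (pOp (dM ι w) (uM ι w) (DinvM ι w) p a b r) = pOp pd uMat dInv p a b (πM ι w v hv r) := by
  rw [pOp_apply, pOp_apply, map_sub, map_smul, map_mul, map_mul, πM_DinvM_same, πM_adjugate_uM, πM_dM_same]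

/-- **`πM ∘ M_{ab,w} = M_{ab} ∘ πM`** (`hπm`). [cite: LeeZhu1998, §5 p. 5032] -/
theorem πM_mOp (q : ℂ) (a b : Fin 2) (r : MCarrier ι) :
    πM ι w v hv (mOp (dM ι w) (uM ι w) q a b r) = mOp pd uMat q a b (πM ι w v hv r) := by
  rw [mOp_apply, mOp_apply, map_add, map_smul, map_mul, πM_uM_same, map_sum]
  congr 1
  refine Finset.sum_congr rfl fun i _ => ?_
  rw [map_sum]
  refine Finset.sum_congr rfl fun j _ => ?_
  rw [map_mul, map_mul, πM_uM_same, πM_uM_same, πM_dM_same]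

/-- **`πM ∘ L_{ab,w} = L_{ab} ∘ πM`** (`hπl`). [cite: KashiwaraVergne1978, §II.5] -/
theorem πM_lOp (a b : Fin 2) (r : MCarrier ι) : πM ι w v hv (lOp (dM ι w) (uM ι w) a b r) = lOp pd uMat a b (πM ι w v hv r) := by
  rw [lOp_apply, lOp_apply, map_sum]
  refine Finset.sum_congr rfl fun k _ => ?_
  rw [map_mul, πM_uM_same, πM_dM_same]

/-- **`πM ∘ R_{ab,w} = R_{ab} ∘ πM`** (`hπr`). [cite: KashiwaraVergne1978, §II.5] -/
theorem πM_rOp (a b : Fin 2) (r : MCarrier ι) : πM ι w v hv (rOp (dM ι w) (uM ι w) a b r) = rOp pd uMat a b (πM ι w v hv r) := by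
  rw [rOp_apply, rOp_apply, map_sum]
  refine Finset.sum_congr rfl fun k _ => ?_
  rw [map_mul, πM_uM_same, πM_dM_same]

end Summit.HodgeConjecture.HodgeConjecture.Cruxes.HLiu418.K2LiuU22MultiPlacePartialEvalDefs

end
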